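import Literature.Analysis.SpecialFunctions.LiebWuKernels
import Literature.MathematicalPhysics.QuantumLattice.LiebWuThermodynamicLimit
import HarnessLib

/-!
# The Lieb–Wu integral equations at general filling and magnetisation (PRL 20 (1968) 1445, eqs. (13)–(17))

Family `hubbard`. The tree states Lieb–Wu's CLOSED FORMS at half filling — the energy
`Literature.Analysis.FunctionSpaces.liebWuEnergy` (eq. (20)), the momentum density
`Literature.MathematicalPhysics.QuantumLattice.liebWuRho0` (eq. (19)), the charge gap (eqs. (22)–(23)) —
and the finite-ring Bethe-ansatz equations (9)–(10) (`IsLiebWuRoots`), but not the printed object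
from which the closed forms are derived and which is the reference for every DOPED chain value
(`N/N_a < 1`): the coupled integral equations (13)–(14) for the densities `ρ(k)`, `σ(Λ)` of the
Bethe momenta and rapidities on `[-Q, Q]`, `[-B, B]`, with the normalisations (15)–(16) fixing
`Q`, `B` from `N/N_a`, `M/N_a`, and the energy (17). This file TYPES them, as printed, as
definitions (no new named fact), and proves the elementary API.

## As printed (Lieb–Wu 1968; reprint: A. Montorsi (ed.), *The Hubbard Model*, p. 67)

"In the limit of `N → ∞`, `N_a → ∞`, `M → ∞` with the ratios `N/N_a`, `M/N_a` kept finite, the real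
numbers `k` and `Λ` are distributed continuously between `-Q` and `Q ≤ π` and `-B` and `B ≤ ∞`,
with density functions `ρ(k)` and `σ(Λ)`" (reprint p. 66, last paragraph), and
* (13) `2πρ(k) = 1 + cos k ∫_{-B}^{B} 8Uσ(Λ)dΛ / (U² + 16(sin k - Λ)²)`,
* (14) `∫_{-Q}^{Q} 8Uρ(k)dk / (U² + 16(Λ - sin k)²) = 2πσ(Λ) + ∫_{-B}^{B} 4Uσ(Λ')dΛ' / (U² + 4(Λ - Λ')²)`,
* "where `Q` and `B` are determined by the conditions" (15) `∫_{-Q}^{Q} ρ(k) dk = N/N_a`,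
  (16) `∫_{-B}^{B} σ(Λ) dΛ = M/N_a`,
* (17) `E = -2N_a ∫_{-Q}^{Q} ρ(k) cos k dk`,
* "(a) Equations (13)–(16) have a unique solution which is positive for all allowed `B` and `Q`.
  (b) `M/N` is a monotonically increasing function of `B` reaching a maximum of `½` at `B = ∞`. This
  is the antiferromagnetic case, `S_z = 0`, and corresponds to the absolute ground state. (c) `N/N_a`
  is a monotonically increasing function of `Q`, reaching a maximum of `1` (half-filled band) at
  `Q = π`."
Lieb–Wu, Physica A 321 (2003) 1, §4, rewrite (13)–(14) with the kernels
`K(x) = (1/2π)·8U/(U² + 16x²)` (the kernel of `K̂`) and `K²(x) = (1/2π)·4U/(U² + 4x²)` (the kernel of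
`K̂²`) as the boxed pair `ρ(k) = 1/2π + cos k ∫_{-B}^{B} K(sin k - Λ) σ(Λ) dΛ`,
`σ(Λ) = ∫_{-Q}^{Q} K(sin k - Λ) ρ(k) dk - ∫_{-B}^{B} K²(Λ - Λ') σ(Λ') dΛ'`, to be solved in
`L¹([-Q, Q]) × L¹([-B, B])` (§5: "the space of functions to be considered is, obviously, `L¹([-a,a])`
for `f` and `L¹([-B,B])` for `σ`"), and PROVE (a) there (§5, Theorem 1: uniqueness and positivity;
existence by the Neumann series; Lemmas 1–4, Theorems 2–3: the monotonicity statements (b)–(c)).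

## What is here

* `IsLiebWuDensities U Q SΛ ρ σ`: `(ρ, σ)` is an `L¹` solution of (13)–(14) with momentum cutoff
  `0 < Q ≤ π` and rapidity range `SΛ = [-B, B]` (`0 < B < ∞`) or `SΛ = ℝ` (`B = ∞`); the kernels are
  written VERBATIM as printed. `IsLiebWuGroundStateDensities U Q ρ σ` is the case `B = ∞` of
  statement (b) (the absolute ground state at the filling fixed by `Q`).
* the functionals (15) `liebWuFilling Q ρ = ∫_{-Q}^{Q} ρ`, (16) `liebWuDownSpinDensity SΛ σ = ∫_{SΛ} σ`,
  (17) per site `liebWuEnergyPerSite Q ρ = -2 ∫_{-Q}^{Q} ρ(k) cos k dk`, and the predicate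
  `IsLiebWuEnergyAt U n e` ("`e` is the value of (17)/`N_a` on a `B = ∞` solution of filling `n`") —
  the object that certified interval evaluations of the doped Bethe-ansatz energy enclose.
* PROVED: the printed kernels are `2π` times the tree's Cauchy kernels,
  `8U/(U² + 16x²) = 2π K_{U/4}(x)`, `4U/(U² + 4x²) = 2π K_{U/2}(x)`
  (`Literature.Analysis.SpecialFunctions.cauchyDensity`; `liebWu_kernel13_eq`, `liebWu_kernel14_eq`),
  hence the Physica A form of (13)–(14) (`IsLiebWuDensities.rho_eq`, `IsLiebWuDensities.sigma_eq`);
  and the half-filled values of the functionals on the tree's `ρ₀` (eq. (19)):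
  `liebWuFilling π ρ₀ = 1` (statement (c) at `Q = π`) and `liebWuEnergyPerSite π ρ₀ = liebWuEnergy U`
  (eq. (17) at `Q = π` is eq. (20)), from `integral_liebWuRho0` and
  `liebWuEnergy_eq_integral_cos_mul_liebWuRho0`.

## What is deliberately NOT here

* No named fact. In particular the sentence "for `n = N/N_a < 1` the ground-state energy density of
  the Hubbard chain (`hubbardChainEnergyDensityAt 1 U p q`) equals the value of (17) on the `B = ∞`
  solution of filling `p/q`" is Lieb–Wu's announced result resting on the Bethe-ansatz hypothesis;
  no complete proof is printed (Lieb–Wu 2003, §2–§3, list the identification of the Bethe state with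
  the ground state as open even at half filling; the tree records the same for `lieb_wu`, see
  `LiebWuBetheAnsatz`), so it is not vendored (a route that wants it files it as an obligation).
* Theorem 1 of Lieb–Wu 2003 (existence, uniqueness, positivity for every `0 < Q ≤ π`, `0 < B ≤ ∞`)
  is a printed theorem whose `B = ∞`, `Q = π` mechanism the tree already proves
  (`LiebWuRootDensityIdentification`); its general-cutoff statement is left to a later discharge and
  is NOT assumed anywhere here (`IsLiebWuEnergyAt` quantifies over solutions instead of choosing one).
* Shiba's single Fredholm equation at `B = ∞` (PRB 6 (1972) 930, eqs. (2.7)–(2.8)) — the form used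
  by numerical evaluations — is a consequence of (13)–(14) by Fourier elimination of `σ`; not typed.

## References

* E. H. Lieb, F. Y. Wu, Phys. Rev. Lett. 20 (1968) 1445–1448, eqs. (13)–(20) and statements
  (a)–(c) (keys `LiebWuPRL1968` = `LiebWu1968`; read from the reprint volume A. Montorsi (ed.),
  The Hubbard Model, World Scientific, pp. 66–67).
* E. H. Lieb, F. Y. Wu, Physica A 321 (2003) 1–27 = arXiv:cond-mat/0207529, §4 (boxed equations,
  kernels `K`, `K²`), §5 (Theorem 1, Lemmas 1–4, Theorems 2–3) (key `LiebWuPhysicaA2003`).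
-/

noncomputable section

open MeasureTheory Set Real intervalIntegral
open Literature.Analysis.SpecialFunctions Literature.Analysis.FunctionSpaces

namespace Literature.MathematicalPhysics.QuantumLattice

/-! ### The printed kernels are `2π` times the Cauchy kernels `K_{U/4}`, `K_{U/2}` -/

/-- The kernel of eq. (13)/(14), left side, is `2π K_{U/4}`:
`8U/(U² + 16x²) = 2π · (U/4)/(π((U/4)² + x²))` (Lieb–Wu 2003, §4: "`K = (1/2π)[8U/(U² + 16(Λ-Λ')²)]`").
Holds for all real `U`, `x` (both sides are `0` at `U = x = 0`). [cite: LiebWuPhysicaA2003, §4, kernel K] -/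
theorem liebWu_kernel13_eq (U x : ℝ) :
    8 * U / (U ^ 2 + 16 * x ^ 2) = 2 * π * cauchyDensity (U / 4) x := by
  rcases eq_or_ne (U ^ 2 + 16 * x ^ 2) 0 with h | h
  · have hU : U = 0 := by nlinarith [sq_nonneg U, sq_nonneg x]
    have hx : x = 0 := by nlinarith [sq_nonneg U, sq_nonneg x]
    simp [cauchyDensity, hU, hx]
  · have h' : π * ((U / 4) ^ 2 + x ^ 2) ≠ 0 := by
      refine mul_ne_zero pi_ne_zero ?_
      intro h0
      apply h
      nlinarith [h0]
    rw [cauchyDensity, ← mul_div_assoc, div_eq_div_iff h h']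
    ring

/-- The kernel of eq. (14), right side, is `2π K_{U/2}`:
`4U/(U² + 4x²) = 2π · (U/2)/(π((U/2)² + x²))` (Lieb–Wu 2003, §4: "`K² = (1/2π)[4U/(U² + 4(Λ-Λ')²)]`").
[cite: LiebWuPhysicaA2003, §4, kernel K²] -/
theorem liebWu_kernel14_eq (U x : ℝ) :
    4 * U / (U ^ 2 + 4 * x ^ 2) = 2 * π * cauchyDensity (U / 2) x := by
  rcases eq_or_ne (U ^ 2 + 4 * x ^ 2) 0 with h | h
  · have hU : U = 0 := by nlinarith [sq_nonneg U, sq_nonneg x]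
    have hx : x = 0 := by nlinarith [sq_nonneg U, sq_nonneg x]
    simp [cauchyDensity, hU, hx]
  · have h' : π * ((U / 2) ^ 2 + x ^ 2) ≠ 0 := by
      refine mul_ne_zero pi_ne_zero ?_
      intro h0
      apply h
      nlinarith [h0]
    rw [cauchyDensity, ← mul_div_assoc, div_eq_div_iff h h']
    ring

/-! ### The functionals (15), (16), (17) -/

/-- Eq. (15), left side: the **filling** `N/N_a = ∫_{-Q}^{Q} ρ(k) dk` of a momentum density `ρ`
with cutoff `Q`. [cite: LiebWuPRL1968, eq. (15)] -/
def liebWuFilling (Q : ℝ) (ρ : ℝ → ℝ) : ℝ :=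
  ∫ k in -Q..Q, ρ k

/-- Eq. (16), left side: the **down-spin density** `M/N_a = ∫_{-B}^{B} σ(Λ) dΛ` of a rapidity
density `σ` on the rapidity range `SΛ` (`= [-B, B]`, or `ℝ` for `B = ∞`). [cite: LiebWuPRL1968, eq. (16)] -/
def liebWuDownSpinDensity (SΛ : Set ℝ) (σ : ℝ → ℝ) : ℝ :=
  ∫ Λ in SΛ, σ Λ

/-- Eq. (17) per site: the **energy density** `E/N_a = -2 ∫_{-Q}^{Q} ρ(k) cos k dk` (hopping
`T = -1`, i.e. the tree's `t = 1`). [cite: LiebWuPRL1968, eq. (17)] -/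
def liebWuEnergyPerSite (Q : ℝ) (ρ : ℝ → ℝ) : ℝ :=
  -2 * ∫ k in -Q..Q, ρ k * Real.cos k

/-- `liebWuFilling` unfolded. [cite: LiebWuPRL1968, eq. (15)] -/
theorem liebWuFilling_eq (Q : ℝ) (ρ : ℝ → ℝ) : liebWuFilling Q ρ = ∫ k in -Q..Q, ρ k := rfl

/-- `liebWuDownSpinDensity` unfolded; for `B = ∞` it is the integral over `ℝ`. [cite: LiebWuPRL1968, eq. (16)] -/
theorem liebWuDownSpinDensity_univ (σ : ℝ → ℝ) : liebWuDownSpinDensity univ σ = ∫ Λ, σ Λ := by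
  rw [liebWuDownSpinDensity, Measure.restrict_univ]

/-- `liebWuEnergyPerSite` unfolded. [cite: LiebWuPRL1968, eq. (17)] -/
theorem liebWuEnergyPerSite_eq (Q : ℝ) (ρ : ℝ → ℝ) :
    liebWuEnergyPerSite Q ρ = -2 * ∫ k in -Q..Q, ρ k * Real.cos k := rfl

/-! ### The coupled integral equations (13)–(14) -/

/-- **The Lieb–Wu integral equations (13)–(14) as printed.** For interaction `U`, momentum cutoff
`Q` with `0 < Q ≤ π`, and rapidity range `SΛ` equal to `[-B, B]` for some `0 < B` or to `ℝ`
(`B = ∞`), the pair of densities `(ρ, σ) ∈ L¹([-Q, Q]) × L¹(SΛ)` satisfies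
(13) `2πρ(k) = 1 + cos k ∫_{SΛ} 8Uσ(Λ)dΛ/(U² + 16(sin k - Λ)²)` for `k ∈ [-Q, Q]` and
(14) `∫_{-Q}^{Q} 8Uρ(k)dk/(U² + 16(Λ - sin k)²) = 2πσ(Λ) + ∫_{SΛ} 4Uσ(Λ')dΛ'/(U² + 4(Λ - Λ')²)` for
`Λ ∈ SΛ`. The equations are required on the printed ranges only (outside them `ρ`, `σ` are not
determined; Lieb–Wu 2003, §4: "Outside these intervals `ρ` and `σ` are not uniquely defined").
Positivity (statement (a)) is a printed PROPERTY of the solution, not part of the definition.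
[cite: LiebWuPRL1968, eqs. (13)–(14)] -/
structure IsLiebWuDensities (U Q : ℝ) (SΛ : Set ℝ) (ρ σ : ℝ → ℝ) : Prop where
  /-- `0 < Q`. -/
  cutoff_pos : 0 < Q
  /-- `Q ≤ π`. -/
  cutoff_le_pi : Q ≤ π
  /-- The rapidity range is `[-B, B]` with `0 < B`, or all of `ℝ` (`B = ∞`). -/
  range_eq : (∃ B : ℝ, 0 < B ∧ SΛ = Icc (-B) B) ∨ SΛ = univ
  /-- `ρ ∈ L¹([-Q, Q])`. -/
  intervalIntegrable_rho : IntervalIntegrable ρ volume (-Q) Q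
  /-- `σ ∈ L¹(SΛ)`. -/
  integrableOn_sigma : IntegrableOn σ SΛ
  /-- Eq. (13). -/
  two_pi_mul_rho_eq : ∀ k ∈ Icc (-Q) Q,
    2 * π * ρ k = 1 + Real.cos k * ∫ Λ in SΛ, 8 * U * σ Λ / (U ^ 2 + 16 * (Real.sin k - Λ) ^ 2)
  /-- Eq. (14). -/
  integral_rho_eq : ∀ Λ ∈ SΛ,
    ∫ k in -Q..Q, 8 * U * ρ k / (U ^ 2 + 16 * (Λ - Real.sin k) ^ 2) =
      2 * π * σ Λ + ∫ Λ' in SΛ, 4 * U * σ Λ' / (U ^ 2 + 4 * (Λ - Λ') ^ 2)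

/-- **The absolute ground state at the filling fixed by `Q`** (statement (b): `B = ∞`, `S_z = 0`):
the Lieb–Wu equations with rapidity range `ℝ`. [cite: LiebWuPRL1968, eqs. (13)–(14) and statement (b)] -/
def IsLiebWuGroundStateDensities (U Q : ℝ) (ρ σ : ℝ → ℝ) : Prop :=
  IsLiebWuDensities U Q univ ρ σ

/-- `IsLiebWuGroundStateDensities` unfolded. [cite: LiebWuPRL1968, statement (b)] -/
theorem isLiebWuGroundStateDensities_iff (U Q : ℝ) (ρ σ : ℝ → ℝ) :
    IsLiebWuGroundStateDensities U Q ρ σ ↔ IsLiebWuDensities U Q univ ρ σ := Iff.rfl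

/-- **"`e` is the Lieb–Wu ground-state energy per site at filling `n`"**: there is a `B = ∞` solution
`(Q, ρ, σ)` of (13)–(14) whose filling (15) is `n` and whose energy (17) per site is `e`. Under
Lieb–Wu 2003, §5 (Theorem 1 with Lemma 4/Theorem 3: for `M = M' = N/2` the normalisation determines
`Q` uniquely) there is exactly one such `e` for each `0 < n ≤ 1`; that theorem is not assumed here.
[cite: LiebWuPRL1968, eqs. (15), (17) and statements (a)–(c)] -/
def IsLiebWuEnergyAt (U n e : ℝ) : Prop :=
  ∃ (Q : ℝ) (ρ σ : ℝ → ℝ), IsLiebWuGroundStateDensities U Q ρ σ ∧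
    liebWuFilling Q ρ = n ∧ liebWuEnergyPerSite Q ρ = e

namespace IsLiebWuDensities

variable {U Q : ℝ} {SΛ : Set ℝ} {ρ σ : ℝ → ℝ}

/-- Eq. (13) in the form of Lieb–Wu 2003, §4 (boxed):
`ρ(k) = 1/2π + cos k ∫_{SΛ} K_{U/4}(sin k - Λ) σ(Λ) dΛ`. [cite: LiebWuPhysicaA2003, §4, boxed equation for ρ] -/
theorem rho_eq (h : IsLiebWuDensities U Q SΛ ρ σ) {k : ℝ} (hk : k ∈ Icc (-Q) Q) :
    ρ k = 1 / (2 * π) + Real.cos k * ∫ Λ in SΛ, cauchyDensity (U / 4) (Real.sin k - Λ) * σ Λ := by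
  have h13 := h.two_pi_mul_rho_eq k hk
  have hint : ∫ Λ in SΛ, 8 * U * σ Λ / (U ^ 2 + 16 * (Real.sin k - Λ) ^ 2) =
      2 * π * ∫ Λ in SΛ, cauchyDensity (U / 4) (Real.sin k - Λ) * σ Λ := by
    rw [← MeasureTheory.integral_const_mul]
    refine integral_congr_ae (Filter.Eventually.of_forall fun Λ => ?_)
    have := liebWu_kernel13_eq U (Real.sin k - Λ)
    calc 8 * U * σ Λ / (U ^ 2 + 16 * (Real.sin k - Λ) ^ 2)
        = 8 * U / (U ^ 2 + 16 * (Real.sin k - Λ) ^ 2) * σ Λ := by ring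
      _ = 2 * π * (cauchyDensity (U / 4) (Real.sin k - Λ) * σ Λ) := by rw [this]; ring
  rw [hint] at h13
  have hπ : (2 : ℝ) * π ≠ 0 := by positivity
  field_simp at h13 ⊢
  linarith [h13]

/-- Eq. (14) in the form of Lieb–Wu 2003, §4 (boxed), solved for `σ`:
`σ(Λ) = ∫_{-Q}^{Q} K_{U/4}(Λ - sin k) ρ(k) dk - ∫_{SΛ} K_{U/2}(Λ - Λ') σ(Λ') dΛ'`.
[cite: LiebWuPhysicaA2003, §4, boxed equation for σ] -/
theorem sigma_eq (h : IsLiebWuDensities U Q SΛ ρ σ) {Λ : ℝ} (hΛ : Λ ∈ SΛ) :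
    σ Λ = (∫ k in -Q..Q, cauchyDensity (U / 4) (Λ - Real.sin k) * ρ k) -
      ∫ Λ' in SΛ, cauchyDensity (U / 2) (Λ - Λ') * σ Λ' := by
  have h14 := h.integral_rho_eq Λ hΛ
  have hl : ∫ k in -Q..Q, 8 * U * ρ k / (U ^ 2 + 16 * (Λ - Real.sin k) ^ 2) =
      2 * π * ∫ k in -Q..Q, cauchyDensity (U / 4) (Λ - Real.sin k) * ρ k := by
    rw [← intervalIntegral.integral_const_mul]
    refine intervalIntegral.integral_congr fun k _ => ?_
    have := liebWu_kernel13_eq U (Λ - Real.sin k)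
    calc 8 * U * ρ k / (U ^ 2 + 16 * (Λ - Real.sin k) ^ 2)
        = 8 * U / (U ^ 2 + 16 * (Λ - Real.sin k) ^ 2) * ρ k := by ring
      _ = 2 * π * (cauchyDensity (U / 4) (Λ - Real.sin k) * ρ k) := by rw [this]; ring
  have hr : ∫ Λ' in SΛ, 4 * U * σ Λ' / (U ^ 2 + 4 * (Λ - Λ') ^ 2) =
      2 * π * ∫ Λ' in SΛ, cauchyDensity (U / 2) (Λ - Λ') * σ Λ' := by
    rw [← MeasureTheory.integral_const_mul]
    refine integral_congr_ae (Filter.Eventually.of_forall fun Λ' => ?_)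
    have := liebWu_kernel14_eq U (Λ - Λ')
    calc 4 * U * σ Λ' / (U ^ 2 + 4 * (Λ - Λ') ^ 2)
        = 4 * U / (U ^ 2 + 4 * (Λ - Λ') ^ 2) * σ Λ' := by ring
      _ = 2 * π * (cauchyDensity (U / 2) (Λ - Λ') * σ Λ') := by rw [this]; ring
  rw [hl, hr] at h14
  have hπ : (0 : ℝ) < 2 * π := by positivity
  have := sub_eq_zero.mpr h14
  nlinarith [this, hπ]

/-- The filling of a solution is the printed left side of (15). [cite: LiebWuPRL1968, eq. (15)] -/
theorem liebWuFilling_eq (_h : IsLiebWuDensities U Q SΛ ρ σ) :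
    liebWuFilling Q ρ = ∫ k in -Q..Q, ρ k := rfl

end IsLiebWuDensities

/-! ### Half filling: the functionals on Lieb–Wu's `ρ₀` (eq. (19)) -/

/-- **Statement (c) at `Q = π` for the closed form (19)**: the half-filled momentum density `ρ₀`
has filling `∫_{-π}^{π} ρ₀ = 1 = N/N_a` (`U > 0`). [cite: LiebWuPRL1968, eq. (15) and statement (c)] -/
theorem liebWuFilling_pi_liebWuRho0 {U : ℝ} (hU : 0 < U) :
    liebWuFilling π (liebWuRho0 U) = 1 := by
  rw [liebWuFilling, integral_liebWuRho0 hU]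

/-- **Eq. (17) at `Q = π` on the closed form (19) is eq. (20)**: the energy per site of `ρ₀` is the
Lieb–Wu energy `-4 ∫₀^∞ J₀J₁/(ω(1 + e^{ωU/2})) dω` (`U > 0`). [cite: LiebWuPRL1968, eqs. (17), (20)] -/
theorem liebWuEnergyPerSite_pi_liebWuRho0 {U : ℝ} (hU : 0 < U) :
    liebWuEnergyPerSite π (liebWuRho0 U) = liebWuEnergy U := by
  rw [liebWuEnergyPerSite, liebWuEnergy_eq_integral_cos_mul_liebWuRho0 hU]
  congr 1
  refine intervalIntegral.integral_congr fun k _ => ?_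
  simp only [mul_comm]

end Literature.MathematicalPhysics.QuantumLattice

end
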